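import Summits.Parity.GeneralizedHardyLittlewood.Theorems.BeyondDiagonalBeatsQuarter.OffDiagDualCostBoxWeight
import HarnessLib

/-!
# Route `PrimeLevelFamEdge`, crux K_B (stmt-Parity-20343), line `diagonal_kernel_split` rev 4, plan Ω,
# lemma L2c (derivative costs), step 7: **the box integral `A_k = ∫∫|∂₁ᵏΦ_i| ≤ S·Dᵏ`, `D = 2(1+Z)/K₁`**

For the box weight `Φ_i = OffDiag.boxWeight q d₁ d₂ α β r i` (`K_j = 2^{i_j}`, box `[K₁/2,2K₁]×[K₂/2,2K₂]`):

* `tsupport_uncurry_boxWeight_subset` — the support of `uncurry Φ_i` lies in the CLOSED box;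
* `iteratedDeriv_boxWeight_slice_eq_zero` — `∂₁ᵏΦ_i(t₁,t₂) = 0` off the closed box;
* `norm_iteratedDeriv_boxWeight_slice_le_const` — on the box `‖∂₁ᵏΦ_i‖ ≤ M_k`,
  `M_k = 𝓒_k·(1+Z)ᵏ·((d₁d₂K₂/2)^{−1/2}r⁻¹(K₁/2)^{−1/2})·((K₁/2)ᵏ)⁻¹` with the BOX value
  `Z = 4π√(αβ·2K₂)/(qr)·√(2K₁)` of the Bessel scale;
* **`integral_norm_iteratedDeriv_boxWeight_le`** — `A_k = ∫∫‖∂₁ᵏΦ_i‖ ≤ (3K₂/2)(3K₁/2)·M_k`, i.e.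
  `A_k ≤ S·Dᵏ` with `S = 𝓒_k (9/4)K₁K₂ (d₁d₂K₂/2)^{−1/2}r⁻¹(K₁/2)^{−1/2}`, `D = 2(1+Z)/K₁`
  (`integral_norm_iteratedDeriv_boxWeight_le_cost`) — the `A_k`-input of `OffDiagDualTruncationBound`.

The companion `B_k = ∫∫‖∂₁ᵏ∂₂²Φ_i‖ ≤ S·Dᵏ·E` (same method after expanding `∂₂²` of the slice; three
profile-type terms) is the last open piece of L2c. Folklore real analysis, PROVED; theorems only. Helper; closes
nothing. «The programme SEARCHES and TYPES; no claim about Landau–Siegel zeros, Theorems 1–2 of arXiv:2211.02515 or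
a repaired Margin232 until a kernel theorem says so.»
-/

noncomputable section

open Real Set Finset MeasureTheory
open scoped Topology ContDiff Nat

namespace Summit.Parity.GeneralizedHardyLittlewood.Theorems.BeyondDiagonalBeatsQuarter.OffDiagPoissonTwisted

open Literature.Analysis.FunctionSpaces Literature.NumberTheory.LFunctions.KMV2000
open Literature.Analysis.Calculus.WhitneyConvex (dyadicBump dyadicBumpBound dyadicBumpBound_nonneg
  dyadicBump_nonneg dyadicBump_le_one)
open OffDiag (boxWeight layerWeightR uncurry_boxWeight mem_box_of_dyadicBump₂_ne_zero contDiff_uncurry_boxWeight)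

section BoxIntegral

variable {q d₁ d₂ α β r : ℕ}

/-- **The box weight is supported in the closed box `[K₁/2, 2K₁] × [K₂/2, 2K₂]`** (`K_j = 2^{i_j}`).
[folklore] -/
theorem tsupport_uncurry_boxWeight_subset (i : ℕ × ℕ) :
    tsupport (Function.uncurry (boxWeight q d₁ d₂ α β r i)) ⊆
      Icc ((2 : ℝ) ^ i.1 / 2) (2 * 2 ^ i.1) ×ˢ Icc ((2 : ℝ) ^ i.2 / 2) (2 * 2 ^ i.2) := by
  refine closure_minimal ?_ (isClosed_Icc.prod isClosed_Icc)
  intro y hy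
  simp only [Function.mem_support, uncurry_boxWeight] at hy
  have hθ : dyadicBump (y.1 / 2 ^ i.1) * dyadicBump (y.2 / 2 ^ i.2) ≠ 0 := by
    intro h; exact hy (by rw [h, Complex.ofReal_zero, zero_mul])
  obtain ⟨⟨a1, a2⟩, ⟨b1, b2⟩⟩ := mem_box_of_dyadicBump₂_ne_zero (by positivity) (by positivity) hθ
  exact ⟨⟨a1.le, a2.le⟩, ⟨b1.le, b2.le⟩⟩

/-- **`∂₁ᵏΦ_i` vanishes off the closed box.** [folklore] -/
theorem iteratedDeriv_boxWeight_slice_eq_zero [NeZero q] (hd₁ : 1 ≤ d₁) (hd₂ : 1 ≤ d₂) (hα : 1 ≤ α)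
    (hβ : 1 ≤ β) (i : ℕ × ℕ) (k : ℕ) {t₁ t₂ : ℝ}
    (h : (t₁, t₂) ∉ Icc ((2 : ℝ) ^ i.1 / 2) (2 * 2 ^ i.1) ×ˢ Icc ((2 : ℝ) ^ i.2 / 2) (2 * 2 ^ i.2)) :
    iteratedDeriv k (fun s : ℝ => boxWeight q d₁ d₂ α β r i s t₂) t₁ = 0 := by
  have hΦ := contDiff_uncurry_boxWeight (q := q) (r := r) hd₁ hd₂ hα hβ i
  rw [iteratedDeriv_slice_left hΦ, iteratedFDeriv_eq_zero_of_notMem_tsupport k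
    (fun hm => h (tsupport_uncurry_boxWeight_subset i hm))]
  simp

/-- **Uniform bound on the box**: for `(t₁,t₂)` in the closed box,
`‖∂₁ᵏΦ_i(t₁,t₂)‖ ≤ 𝓒_k (1+Z)ᵏ · ((d₁d₂K₂/2)^{−1/2} r⁻¹ (K₁/2)^{−1/2}) · ((K₁/2)ᵏ)⁻¹`,
`Z = 4π√(αβ·2K₂)/(qr)·√(2K₁)`. [folklore] -/
theorem norm_iteratedDeriv_boxWeight_slice_le_const [NeZero q] (hd₁ : 1 ≤ d₁) (hd₂ : 1 ≤ d₂)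
    (i : ℕ × ℕ) (k : ℕ) {t₁ t₂ : ℝ} (ht₁ : t₁ ∈ Icc ((2 : ℝ) ^ i.1 / 2) (2 * 2 ^ i.1))
    (ht₂ : t₂ ∈ Icc ((2 : ℝ) ^ i.2 / 2) (2 * 2 ^ i.2)) :
    ‖iteratedDeriv k (fun s : ℝ => boxWeight q d₁ d₂ α β r i s t₂) t₁‖ ≤
      (∑ j ∈ Finset.range (k + 1), (k.choose j : ℝ) * (2 ^ j * dyadicBumpBound j) *
          ((((k - j : ℕ) : ℝ) + 1) ^ 2 * (k - j) ! * ((k - j : ℕ) : ℝ) ^ (k - j))) *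
        (1 + 4 * π * Real.sqrt ((α : ℝ) * β * (2 * 2 ^ i.2)) / ((q : ℝ) * r) * Real.sqrt (2 * 2 ^ i.1)) ^ k *
        (((d₁ : ℝ) * d₂ * (2 ^ i.2 / 2)) ^ (-(1 : ℝ) / 2) * (r : ℝ)⁻¹ * ((2 : ℝ) ^ i.1 / 2) ^ (-(1 : ℝ) / 2)) *
        ((((2 : ℝ) ^ i.1 / 2) ^ k)⁻¹) := by
  obtain ⟨h1l, h1u⟩ := ht₁
  obtain ⟨h2l, h2u⟩ := ht₂
  have hK₁ : (0 : ℝ) < 2 ^ i.1 / 2 := by positivity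
  have hK₂ : (0 : ℝ) < 2 ^ i.2 / 2 := by positivity
  have ht₁0 : 0 < t₁ := hK₁.trans_le h1l
  have ht₂0 : 0 < t₂ := hK₂.trans_le h2l
  have hd : (0 : ℝ) < (d₁ : ℝ) * d₂ := by
    have : (0 : ℝ) < d₁ := by exact_mod_cast hd₁
    have : (0 : ℝ) < d₂ := by exact_mod_cast hd₂
    positivity
  have hmain := norm_iteratedDeriv_boxWeight_slice_le (q := q) (α := α) (β := β) (r := r) hd₁ hd₂ i k ht₂0
    ht₁0 h1u
  refine hmain.trans ?_
  have hC0 : 0 ≤ ∑ j ∈ Finset.range (k + 1), (k.choose j : ℝ) * (2 ^ j * dyadicBumpBound j) *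
      ((((k - j : ℕ) : ℝ) + 1) ^ 2 * (k - j) ! * ((k - j : ℕ) : ℝ) ^ (k - j)) :=
    Finset.sum_nonneg fun j _ => by have := dyadicBumpBound_nonneg j; positivity
  -- factor 1: the Bessel scale
  have hqr : 0 ≤ (q : ℝ) * r := by positivity
  have hZ : 1 + |4 * π * Real.sqrt ((α : ℝ) * β * t₂) / ((q : ℝ) * r)| * Real.sqrt t₁ ≤
      1 + 4 * π * Real.sqrt ((α : ℝ) * β * (2 * 2 ^ i.2)) / ((q : ℝ) * r) * Real.sqrt (2 * 2 ^ i.1) := by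
    rw [abs_of_nonneg (by positivity)]
    have h1 : Real.sqrt ((α : ℝ) * β * t₂) ≤ Real.sqrt ((α : ℝ) * β * (2 * 2 ^ i.2)) :=
      Real.sqrt_le_sqrt (by gcongr)
    have h2 : Real.sqrt t₁ ≤ Real.sqrt (2 * 2 ^ i.1) := Real.sqrt_le_sqrt h1u
    have h3 : 4 * π * Real.sqrt ((α : ℝ) * β * t₂) / ((q : ℝ) * r) ≤
        4 * π * Real.sqrt ((α : ℝ) * β * (2 * 2 ^ i.2)) / ((q : ℝ) * r) :=
      div_le_div_of_nonneg_right (by gcongr) hqr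
    have h4 : 0 ≤ 4 * π * Real.sqrt ((α : ℝ) * β * (2 * 2 ^ i.2)) / ((q : ℝ) * r) := by positivity
    nlinarith [mul_le_mul h3 h2 (Real.sqrt_nonneg _) h4, Real.sqrt_nonneg t₁,
      mul_nonneg (show 0 ≤ 4 * π * Real.sqrt ((α : ℝ) * β * t₂) / ((q : ℝ) * r) by positivity)
        (Real.sqrt_nonneg t₁)]
  have hZ0 : 0 ≤ 1 + |4 * π * Real.sqrt ((α : ℝ) * β * t₂) / ((q : ℝ) * r)| * Real.sqrt t₁ := by positivity
  -- factor 2: the size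
  have hθ : |dyadicBump (t₂ / 2 ^ i.2)| ≤ 1 := by
    rw [abs_of_nonneg (dyadicBump_nonneg _)]; exact dyadicBump_le_one _
  have hsize : |((d₁ : ℝ) * d₂ * t₂) ^ (-(1 : ℝ) / 2) * (r : ℝ)⁻¹| * t₁ ^ (-(1 : ℝ) / 2) ≤
      ((d₁ : ℝ) * d₂ * (2 ^ i.2 / 2)) ^ (-(1 : ℝ) / 2) * (r : ℝ)⁻¹ * ((2 : ℝ) ^ i.1 / 2) ^ (-(1 : ℝ) / 2) := by
    rw [abs_of_nonneg (by positivity)]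
    have e1 : ((d₁ : ℝ) * d₂ * t₂) ^ (-(1 : ℝ) / 2) ≤ ((d₁ : ℝ) * d₂ * (2 ^ i.2 / 2)) ^ (-(1 : ℝ) / 2) :=
      Real.rpow_le_rpow_of_nonpos (by positivity) (by nlinarith) (by norm_num)
    have e2 : t₁ ^ (-(1 : ℝ) / 2) ≤ ((2 : ℝ) ^ i.1 / 2) ^ (-(1 : ℝ) / 2) :=
      Real.rpow_le_rpow_of_nonpos hK₁ h1l (by norm_num)
    have e3 : (0 : ℝ) ≤ (r : ℝ)⁻¹ := by positivity
    exact mul_le_mul (mul_le_mul_of_nonneg_right e1 e3) e2 (by positivity) (by positivity)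
  -- factor 3: `(t₁^k)⁻¹`
  have hpow : (t₁ ^ k)⁻¹ ≤ (((2 : ℝ) ^ i.1 / 2) ^ k)⁻¹ :=
    inv_anti₀ (pow_pos hK₁ k) (pow_le_pow_left₀ hK₁.le h1l k)
  have hθsize : |dyadicBump (t₂ / 2 ^ i.2)| * (|((d₁ : ℝ) * d₂ * t₂) ^ (-(1 : ℝ) / 2) * (r : ℝ)⁻¹| *
      t₁ ^ (-(1 : ℝ) / 2)) ≤ ((d₁ : ℝ) * d₂ * (2 ^ i.2 / 2)) ^ (-(1 : ℝ) / 2) * (r : ℝ)⁻¹ *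
        ((2 : ℝ) ^ i.1 / 2) ^ (-(1 : ℝ) / 2) := by
    have h0 : 0 ≤ |((d₁ : ℝ) * d₂ * t₂) ^ (-(1 : ℝ) / 2) * (r : ℝ)⁻¹| * t₁ ^ (-(1 : ℝ) / 2) := by positivity
    calc _ ≤ 1 * (|((d₁ : ℝ) * d₂ * t₂) ^ (-(1 : ℝ) / 2) * (r : ℝ)⁻¹| * t₁ ^ (-(1 : ℝ) / 2)) :=
          mul_le_mul_of_nonneg_right hθ h0
      _ ≤ _ := by rw [one_mul]; exact hsize
  have hZk := pow_le_pow_left₀ hZ0 hZ k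
  gcongr

/-- The single slice integral: `∫ ‖∂₁ᵏΦ_i(t₁,t₂)‖ dt₁ ≤ (3K₁/2)·M_k` on the `t₂`-box and `= 0` off it
(bounded by an indicator). [folklore] -/
theorem integral_norm_iteratedDeriv_boxWeight_slice_le [NeZero q] (hd₁ : 1 ≤ d₁) (hd₂ : 1 ≤ d₂)
    (hα : 1 ≤ α) (hβ : 1 ≤ β) (i : ℕ × ℕ) (k : ℕ) {M : ℝ}
    (hM : ∀ t₁ t₂, t₁ ∈ Icc ((2 : ℝ) ^ i.1 / 2) (2 * 2 ^ i.1) → t₂ ∈ Icc ((2 : ℝ) ^ i.2 / 2) (2 * 2 ^ i.2) →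
      ‖iteratedDeriv k (fun s : ℝ => boxWeight q d₁ d₂ α β r i s t₂) t₁‖ ≤ M) (t₂ : ℝ) :
    (∫ t₁, ‖iteratedDeriv k (fun s : ℝ => boxWeight q d₁ d₂ α β r i s t₂) t₁‖) ≤
      (Icc ((2 : ℝ) ^ i.2 / 2) (2 * 2 ^ i.2)).indicator (fun _ => (3 * 2 ^ i.1 / 2) * M) t₂ := by
  classical
  by_cases ht₂ : t₂ ∈ Icc ((2 : ℝ) ^ i.2 / 2) (2 * 2 ^ i.2)
  · rw [Set.indicator_of_mem ht₂]
    have hle : ∀ t₁, ‖iteratedDeriv k (fun s : ℝ => boxWeight q d₁ d₂ α β r i s t₂) t₁‖ ≤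
        (Icc ((2 : ℝ) ^ i.1 / 2) (2 * 2 ^ i.1)).indicator (fun _ => M) t₁ := by
      intro t₁
      by_cases ht₁ : t₁ ∈ Icc ((2 : ℝ) ^ i.1 / 2) (2 * 2 ^ i.1)
      · rw [Set.indicator_of_mem ht₁]; exact hM t₁ t₂ ht₁ ht₂
      · rw [Set.indicator_of_notMem ht₁, iteratedDeriv_boxWeight_slice_eq_zero hd₁ hd₂ hα hβ i k
          (fun h => ht₁ h.1), norm_zero]
    calc (∫ t₁, ‖iteratedDeriv k (fun s : ℝ => boxWeight q d₁ d₂ α β r i s t₂) t₁‖)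
        ≤ ∫ t₁, (Icc ((2 : ℝ) ^ i.1 / 2) (2 * 2 ^ i.1)).indicator (fun _ => M) t₁ :=
          integral_mono_of_nonneg (Filter.Eventually.of_forall fun _ => norm_nonneg _)
            ((integrableOn_const (measure_Icc_lt_top.ne)).integrable_indicator measurableSet_Icc)
            (Filter.Eventually.of_forall hle)
      _ = (3 * 2 ^ i.1 / 2) * M := by
          rw [integral_indicator_const _ measurableSet_Icc, smul_eq_mul,
            Real.volume_real_Icc_of_le (by linarith [show (0 : ℝ) ≤ 2 ^ i.1 by positivity])]
          ring
  · rw [Set.indicator_of_notMem ht₂]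
    have hz : ∀ t₁, ‖iteratedDeriv k (fun s : ℝ => boxWeight q d₁ d₂ α β r i s t₂) t₁‖ = 0 := by
      intro t₁
      rw [iteratedDeriv_boxWeight_slice_eq_zero hd₁ hd₂ hα hβ i k (fun h => ht₂ h.2), norm_zero]
    simp [hz]

/-- **The box integral**: `A_k = ∫∫‖∂₁ᵏΦ_i‖ ≤ (3K₂/2)·(3K₁/2)·M` whenever `‖∂₁ᵏΦ_i‖ ≤ M` on the box.
[folklore] -/
theorem integral_integral_norm_iteratedDeriv_boxWeight_le [NeZero q] (hd₁ : 1 ≤ d₁) (hd₂ : 1 ≤ d₂)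
    (hα : 1 ≤ α) (hβ : 1 ≤ β) (i : ℕ × ℕ) (k : ℕ) {M : ℝ}
    (hM : ∀ t₁ t₂, t₁ ∈ Icc ((2 : ℝ) ^ i.1 / 2) (2 * 2 ^ i.1) → t₂ ∈ Icc ((2 : ℝ) ^ i.2 / 2) (2 * 2 ^ i.2) →
      ‖iteratedDeriv k (fun s : ℝ => boxWeight q d₁ d₂ α β r i s t₂) t₁‖ ≤ M) :
    (∫ t₂, ∫ t₁, ‖iteratedDeriv k (fun s : ℝ => boxWeight q d₁ d₂ α β r i s t₂) t₁‖) ≤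
      (3 * 2 ^ i.2 / 2) * ((3 * 2 ^ i.1 / 2) * M) := by
  classical
  calc (∫ t₂, ∫ t₁, ‖iteratedDeriv k (fun s : ℝ => boxWeight q d₁ d₂ α β r i s t₂) t₁‖)
      ≤ ∫ t₂, (Icc ((2 : ℝ) ^ i.2 / 2) (2 * 2 ^ i.2)).indicator (fun _ => (3 * 2 ^ i.1 / 2) * M) t₂ :=
        integral_mono_of_nonneg
          (Filter.Eventually.of_forall fun _ => integral_nonneg fun _ => norm_nonneg _)
          ((integrableOn_const (measure_Icc_lt_top.ne)).integrable_indicator measurableSet_Icc)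
          (Filter.Eventually.of_forall
            (integral_norm_iteratedDeriv_boxWeight_slice_le hd₁ hd₂ hα hβ i k hM))
    _ = (3 * 2 ^ i.2 / 2) * ((3 * 2 ^ i.1 / 2) * M) := by
        rw [integral_indicator_const _ measurableSet_Icc, smul_eq_mul,
          Real.volume_real_Icc_of_le (by linarith [show (0 : ℝ) ≤ 2 ^ i.2 by positivity])]
        ring

/-- **`A_k ≤ S·Dᵏ` for the box weight** (the `A_k`-input of `OffDiagDualTruncationBound`): with
`𝓒_k = Σ_j binom(k,j) 2ʲΘⱼ((k−j)+1)²(k−j)!(k−j)^{k−j}`, `Z = 4π√(αβ·2K₂)/(qr)·√(2K₁)`,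
`S = (3K₂/2)(3K₁/2)·𝓒_k·(d₁d₂K₂/2)^{−1/2}r⁻¹(K₁/2)^{−1/2}` and `D = (1+Z)/(K₁/2)`:
`∫∫‖∂₁ᵏΦ_i‖ ≤ S·Dᵏ`. [folklore] -/
theorem integral_norm_iteratedDeriv_boxWeight_le_cost [NeZero q] (hd₁ : 1 ≤ d₁) (hd₂ : 1 ≤ d₂)
    (hα : 1 ≤ α) (hβ : 1 ≤ β) (i : ℕ × ℕ) (k : ℕ) :
    (∫ t₂, ∫ t₁, ‖iteratedDeriv k (fun s : ℝ => boxWeight q d₁ d₂ α β r i s t₂) t₁‖) ≤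
      ((3 * 2 ^ i.2 / 2) * (3 * 2 ^ i.1 / 2) *
        (∑ j ∈ Finset.range (k + 1), (k.choose j : ℝ) * (2 ^ j * dyadicBumpBound j) *
          ((((k - j : ℕ) : ℝ) + 1) ^ 2 * (k - j) ! * ((k - j : ℕ) : ℝ) ^ (k - j))) *
        (((d₁ : ℝ) * d₂ * (2 ^ i.2 / 2)) ^ (-(1 : ℝ) / 2) * (r : ℝ)⁻¹ * ((2 : ℝ) ^ i.1 / 2) ^ (-(1 : ℝ) / 2))) *
      ((1 + 4 * π * Real.sqrt ((α : ℝ) * β * (2 * 2 ^ i.2)) / ((q : ℝ) * r) * Real.sqrt (2 * 2 ^ i.1)) /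
        ((2 : ℝ) ^ i.1 / 2)) ^ k := by
  have hC0 : 0 ≤ ∑ j ∈ Finset.range (k + 1), (k.choose j : ℝ) * (2 ^ j * dyadicBumpBound j) *
      ((((k - j : ℕ) : ℝ) + 1) ^ 2 * (k - j) ! * ((k - j : ℕ) : ℝ) ^ (k - j)) :=
    Finset.sum_nonneg fun j _ => by have := dyadicBumpBound_nonneg j; positivity
  refine (integral_integral_norm_iteratedDeriv_boxWeight_le hd₁ hd₂ hα hβ i k
    fun t₁ t₂ ht₁ ht₂ => norm_iteratedDeriv_boxWeight_slice_le_const hd₁ hd₂ i k ht₁ ht₂).trans (le_of_eq ?_)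
  set Zm : ℝ := 1 + 4 * π * Real.sqrt ((α : ℝ) * β * (2 * 2 ^ i.2)) / ((q : ℝ) * r) * Real.sqrt (2 * 2 ^ i.1)
  set Kh : ℝ := (2 : ℝ) ^ i.1 / 2
  have hdiv : (Zm / Kh) ^ k = Zm ^ k * (Kh ^ k)⁻¹ := by rw [div_pow, div_eq_mul_inv]
  rw [hdiv]
  ring

end BoxIntegral

end Summit.Parity.GeneralizedHardyLittlewood.Theorems.BeyondDiagonalBeatsQuarter.OffDiagPoissonTwisted
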